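import Literature.NumberTheory.Rogawski1990.ArchStableOrbitalWallDerivCM        -- ★ p840906: J1 unconditional for CM `L` (`…_of_isCMField`); brings J1 ★ p840417, J1-glue ★ p840351
import Literature.NumberTheory.Automorphic.ArchOrbitMeasureFubini                -- ★ p841084 (R1-b′): orbit-measure Fubini; brings ★ (R1-a) p841031
import Literature.MeasureTheory.Group.OrbitMeasureOfClosedClass                 -- ★ (R1-f): orbit measures of closed classes (`integral_descConj_comp_equiv_eq_integral_map_map`)
import Literature.NumberTheory.Automorphic.ArchTorusOrbitalFubiniProper             -- ★ p840971 (δ8) §3: properness at regular points ∕ compact split walls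
import Literature.NumberTheory.Automorphic.ArchPiMeasureInsert                      -- ★ p841365 (R3-f) F0P3a-p02: `isFiniteMeasureOnCompacts_update`, `sigmaFinite_update` (generic updated families)
import HarnessLib

/-!
# THE ONE-STEP JUMP AT A PLACE `w` IN ALL-PLACES ORBIT-MEASURE CURRENCY ((R1-e′) of R1 «(L-use) at all indefinite places»; Rogawski 1990 §8.2 p. 122–124,
# §14.5 p. 238–239 «method of §8.2», one place at a time)

Topic `NumberTheory/Rogawski1990`; namespace `Literature.NumberTheory.Rogawski1990` (§2) and `Literature.NumberTheory.Automorphic.UnitaryGroup` (§1, `N`-general).  THEOREMS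
ONLY (no `def`, no instance, no notation, no axiom, no `sorry`).  Cell `pub/hodgecm-mathlib`, ENGINE T1 (crux H413 = `stmt-HodgeConjecture-24833`); floor-2 road «(J-nc) in-house»,
brick (R1-e′) of R1 `stub_LuseAllPlaces` (LEAD F0P3a-plan (g9) WORDS T8-53 ∕ T8-57 ∕ T8-61; census `CENSUS-R1-LuseAllPlaces` 8d436054; author F0P3a-p07 (g7), 2026-09-01).

THE STATE of R1's induction (orbit-measure currency): a family `μ = (μ_v)_v` of Radon measures on the `G_v` and the global test function `Θ` give the number
`I(μ) := ∫ Θ ↑↑(e⁻¹ o) d(⊗_v μ_v)(o)`.  Before the place `w` moves, `μ_w` is the REGULAR ORBIT MEASURE `ν.map (y ↦ y·diag(γ_{z₀}(ψ)∘ρ)·y⁻¹)` of the curve point; THE STEP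
(§2 `exists_tendsto_deriv_sin_mul_sum_integral_pi_update_splitCurve`): `∂_ψ [2 sin ψ · Σ_{ρ∈S₃} I(μ[w ↦ reg(γ(ψ)∘ρ)])] ⟶ Σ_ρ ℓ_ρ` (`ψ → 0+`), with
`ℓ_ρ = 2 · I(μ[w ↦ ν.map (y ↦ y·diag(z₀∘ρ)·y⁻¹)])` at a COMPACT `w`-wall of `ρ` and `ℓ_ρ = c_{ρ⁻¹} · I(μ[w ↦ μ^{sing}_ρ])` at a NONCOMPACT one, where
`μ^{sing}_ρ := ((quotientMeasure Z (νH ρ⁻¹) _ (ν.map e_{ρ⁻¹}⁻¹)).map (orbit map of diag z₀)).map e_{ρ⁻¹}` is the SINGULAR ORBIT MEASURE on `G_w(α)` (J1's quotient integral read through ★ (R1-f)),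
`c τ ≠ 0` J1's constants (independent of `Θ`, `μ`, `z₀`; CM `L`, unconditional ★ p840906).  So the output is again a state of the same shape — with `μ_w` now a (compact- or
noncompact-) WALL orbit measure, Radon by ★ (δ8) p840971 §3 ∕ ★ (R1-f) — and the next indefinite place can move: (L-use) applies this theorem `|I|` times to both sides of ★ (14.2.1).
§1 (`N`-general): `integral_pi_eq_integral_mixedPartial` — `I(μ) = ∫_{G_w} MP dμ_w` for ANY `μ_w` (★ (R1-b′) `integral_pi_eq_integral_integral_assemble` at `F = Θ ∘ coe ∘ e⁻¹`), the updated
family `μ[w ↦ m]` off `w`, and the finiteness on compacts of a PROPER orbit measure (updated families stay Radon ∕ σ-finite: ★ p841365 F0P3a-p02 (R3-f), imported).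
HONEST LABEL: HC_CM is proved only modulo the 7 printed citations until rung 0 closes; this file is J1 ★ + (R1-a) ★ + (R1-b′) ★ + (R1-f) ★ bookkeeping and pays nothing by itself.

## References
* [Rogawski1990] J. D. Rogawski, *Automorphic Representations of Unitary Groups in Three Variables*, Ann. of Math. Stud. 123 (1990), §8.2 p. 122–124, §8.3 p. 122, §14.5 p. 238–239.
* [Varadarajan1989] V. S. Varadarajan, *An Introduction to Harmonic Analysis on Semisimple Lie Groups* (1989), §6.4 Thm 22.
* [BorelJacquet1979] A. Borel, H. Jacquet, *Automorphic forms and automorphic representations*, PSPM 33.1 (1979), §4.1.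
* [DeitmarEchterhoff2014] A. Deitmar, S. Echterhoff, *Principles of Harmonic Analysis*, 2nd ed. (2014), Lemma 9.3.3, Thm. 1.5.3.
-/

set_option autoImplicit false

noncomputable section

open MeasureTheory Measure Filter Topology NumberField NumberField.InfinitePlace NumberField.mixedEmbedding Equiv Function Set
open Literature.MeasureTheory.Group Literature.NumberTheory.Automorphic Literature.NumberTheory.Automorphic.UnitaryGroup
open Literature.LinearAlgebra.Matrix
open scoped Matrix MatrixGroups Matrix.Norms.Operator ContDiff

namespace Literature.NumberTheory.Automorphic.UnitaryGroup

/-! ## §1 (`N`-general) The state against an arbitrary measure at `w`; updated families stay Radon -/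

section State

variable (L : Type) [Field L] [NumberField L] [IsCMField L] (N : ℕ) (α : Fin N → L) (w : {w : InfinitePlace L // IsComplex w})
  [∀ v : {w : InfinitePlace L // IsComplex w}, MeasurableSpace (archLocal L N (Matrix.diagonal α) v)]
  [∀ v : {w : InfinitePlace L // IsComplex w}, BorelSpace (archLocal L N (Matrix.diagonal α) v)]

open scoped Classical in
/-- **THE STATE IS THE `w`-INTEGRAL OF THE MIXED PARTIAL INTEGRAL, for ANY measure at `w`**: `∫ Θ ↑↑(e⁻¹ o) d(⊗_v μ_v) = ∫_{G_w} MP(x) dμ_w(x)`,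
`MP(x) = ∫ Θ ↑↑(e⁻¹(x, o′)) d(⊗_{v≠w} μ_v)` (★ (R1-b′) `integral_pi_eq_integral_integral_assemble` at `F = Θ ∘ coe ∘ e⁻¹`, integrable by compact support).
[cite: BorelJacquet1979, §4.1] [cite: Rogawski1990, §8.3 p. 122] -/
theorem integral_pi_eq_integral_mixedPartial {E : Type*} [NormedAddCommGroup E] [NormedSpace ℝ E]
    (μall : ∀ v : {w : InfinitePlace L // IsComplex w}, Measure (archLocal L N (Matrix.diagonal α) v)) [∀ v, IsFiniteMeasureOnCompacts (μall v)] [∀ v, SigmaFinite (μall v)]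
    (Θ : Matrix (Fin N) (Fin N) (mixedSpace L) → E) (hΘ : Continuous Θ)
    (hΘc : HasCompactSupport fun g : arch (↥(maximalRealSubfield L)) L (IsCMField.complexConj L) N (Matrix.diagonal α) => Θ ((g : GL (Fin N) (mixedSpace L)) : Matrix (Fin N) (Fin N) (mixedSpace L))) :
    ∫ o, Θ ((((archPiEquivCM N L (Matrix.diagonal α)).symm o : arch (↥(maximalRealSubfield L)) L (IsCMField.complexConj L) N (Matrix.diagonal α)) : GL (Fin N) (mixedSpace L)) : Matrix (Fin N) (Fin N) (mixedSpace L)) ∂(Measure.pi μall) =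
      ∫ x : archLocal L N (Matrix.diagonal α) w,
        ∫ o' : (∀ w' : {v : {w : InfinitePlace L // IsComplex w} // ¬ v = w}, archLocal L N (Matrix.diagonal α) w'.1),
          Θ ((((archPiEquivCM N L (Matrix.diagonal α)).symm ((MeasurableEquiv.piEquivPiSubtypeProd (fun v : {w : InfinitePlace L // IsComplex w} => ↥(archLocal L N (Matrix.diagonal α) v)) (· = w)).symm
          ((MeasurableEquiv.piUnique fun i : {v : {w : InfinitePlace L // IsComplex w} // v = w} => ↥(archLocal L N (Matrix.diagonal α) i.1)).symm x, o')) : arch (↥(maximalRealSubfield L)) L (IsCMField.complexConj L) N (Matrix.diagonal α)) : GL (Fin N) (mixedSpace L)) : Matrix (Fin N) (Fin N) (mixedSpace L))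
          ∂(Measure.pi fun w' : {v : {w : InfinitePlace L // IsComplex w} // ¬ v = w} => μall w'.1) ∂(μall w) := by
  haveI : ∀ v : {w : InfinitePlace L // IsComplex w}, LocallyCompactSpace (archLocal L N (Matrix.diagonal α) v) := fun v => locallyCompactSpace_archLocal L N (Matrix.diagonal α) v
  haveI : ∀ v : {w : InfinitePlace L // IsComplex w}, SecondCountableTopology (archLocal L N (Matrix.diagonal α) v) := fun v => secondCountableTopology_archLocal L N (Matrix.diagonal α) v
  have hc : Continuous fun g : arch (↥(maximalRealSubfield L)) L (IsCMField.complexConj L) N (Matrix.diagonal α) => Θ ((g : GL (Fin N) (mixedSpace L)) : Matrix (Fin N) (Fin N) (mixedSpace L)) :=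
    hΘ.comp (Units.continuous_val.comp continuous_subtype_val)
  exact integral_pi_eq_integral_integral_assemble L N α w μall _
    ((hc.comp (archPiEquivCM N L (Matrix.diagonal α)).symm.continuous).integrable_of_hasCompactSupport
      (hΘc.comp_homeomorph (archPiEquivCM N L (Matrix.diagonal α)).symm.toHomeomorph))

omit [NumberField L] [IsCMField L] [∀ v : {w : InfinitePlace L // IsComplex w}, BorelSpace (archLocal L N (Matrix.diagonal α) v)] in
open scoped Classical in
/-- Off `w` the updated family is the old one (stated over the subtype `{v // v ≠ w}`, for rewriting under binders). [cite: BorelJacquet1979, §4.1] -/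
theorem update_apply_coe_of_ne (μall : ∀ v : {w : InfinitePlace L // IsComplex w}, Measure (archLocal L N (Matrix.diagonal α) v)) (m : Measure (archLocal L N (Matrix.diagonal α) w))
    (w' : {v : {w : InfinitePlace L // IsComplex w} // ¬ v = w}) : Function.update μall w m w'.1 = μall w'.1 :=
  Function.update_of_ne w'.2 _ _

omit [NumberField L] [IsCMField L] in
/-- **A PROPER orbit map pushes a measure finite on compacts to a measure finite on compacts**: if `{g | g·d·g⁻¹ ∈ C}` is compact for every compact `C` (regular points ★, compact
walls ★ p840971 §3), then the orbit measure `ν.map (y ↦ y·d·y⁻¹)` is finite on compacts. [cite: Rogawski1990, §8.3 p. 122] [cite: DeitmarEchterhoff2014, Lemma 9.3.3] -/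
theorem isFiniteMeasureOnCompacts_map_conj_of_proper (ν : Measure (archLocal L N (Matrix.diagonal α) w)) [IsFiniteMeasureOnCompacts ν]
    (d : archLocal L N (Matrix.diagonal α) w)
    (hprop : ∀ C : Set (archLocal L N (Matrix.diagonal α) w), IsCompact C → IsCompact {g : archLocal L N (Matrix.diagonal α) w | g * d * g⁻¹ ∈ C}) :
    IsFiniteMeasureOnCompacts (ν.map fun y : archLocal L N (Matrix.diagonal α) w => y * d * y⁻¹) := by
  refine ⟨fun K hK => ?_⟩
  have hm : Measurable fun y : archLocal L N (Matrix.diagonal α) w => y * d * y⁻¹ := ((continuous_id.mul continuous_const).mul continuous_id.inv).measurable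
  rw [Measure.map_apply hm hK.measurableSet]
  exact (hprop K hK).measure_lt_top

end State

end Literature.NumberTheory.Automorphic.UnitaryGroup

namespace Literature.NumberTheory.Rogawski1990

variable (L : Type) [Field L] [NumberField L] [IsCMField L] (α : Fin 3 → L) (w : {w : InfinitePlace L // IsComplex w})
  [MeasurableSpace (GL (Fin 3) ℂ)] [BorelSpace (GL (Fin 3) ℂ)]

/-! ## §2 The three readings of the state at `w` (N = 3): any measure, a proper regular orbit measure, a singular orbit measure -/

open scoped Classical in
/-- **STATE WITH AN ARBITRARY MEASURE AT `w`**: if `Θ′` restricts to the mixed partial integral `MP` (★ (R1-a)), then `I(μ[w ↦ m]) = ∫ Θ′ ↑↑x dm(x)` (§1 + `update` bookkeeping).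
[cite: BorelJacquet1979, §4.1] [cite: Rogawski1990, §8.3 p. 122] -/
theorem integral_pi_update_eq_integral_of_eq_mixedPartial
    [MeasurableSpace (arch (↥(maximalRealSubfield L)) L (IsCMField.complexConj L) 3 (Matrix.diagonal α))] [BorelSpace (arch (↥(maximalRealSubfield L)) L (IsCMField.complexConj L) 3 (Matrix.diagonal α))]
    (μall : ∀ v : {w : InfinitePlace L // IsComplex w}, Measure (archLocal L 3 (Matrix.diagonal α) v)) [∀ v, IsFiniteMeasureOnCompacts (μall v)] [∀ v, SigmaFinite (μall v)]
    (m : Measure (archLocal L 3 (Matrix.diagonal α) w)) [IsFiniteMeasureOnCompacts m] [SigmaFinite m]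
    (Θ : Matrix (Fin 3) (Fin 3) (mixedSpace L) → ℂ) (hΘ : Continuous Θ)
    (hΘc : HasCompactSupport fun g : arch (↥(maximalRealSubfield L)) L (IsCMField.complexConj L) 3 (Matrix.diagonal α) => Θ ((g : GL (Fin 3) (mixedSpace L)) : Matrix (Fin 3) (Fin 3) (mixedSpace L)))
    (Θ' : Matrix (Fin 3) (Fin 3) ℂ → ℂ)
    (hΘ'eq : ∀ x : archLocal L 3 (Matrix.diagonal α) w, Θ' ((x : GL (Fin 3) ℂ) : Matrix (Fin 3) (Fin 3) ℂ) = ∫ o' : (∀ w' : {v : {w : InfinitePlace L // IsComplex w} // ¬ v = w}, archLocal L 3 (Matrix.diagonal α) w'.1),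
          Θ ((((archPiEquivCM 3 L (Matrix.diagonal α)).symm
            ((MeasurableEquiv.piEquivPiSubtypeProd (fun v : {w : InfinitePlace L // IsComplex w} => ↥(archLocal L 3 (Matrix.diagonal α) v)) (· = w)).symm
              ((MeasurableEquiv.piUnique fun i : {v : {w : InfinitePlace L // IsComplex w} // v = w} => ↥(archLocal L 3 (Matrix.diagonal α) i.1)).symm x, o')) : arch (↥(maximalRealSubfield L)) L (IsCMField.complexConj L) 3 (Matrix.diagonal α)) :
            GL (Fin 3) (mixedSpace L)) : Matrix (Fin 3) (Fin 3) (mixedSpace L)) ∂(Measure.pi fun w' : {v : {w : InfinitePlace L // IsComplex w} // ¬ v = w} => μall w'.1)) :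
    ∫ o, Θ ((((archPiEquivCM 3 L (Matrix.diagonal α)).symm o : arch (↥(maximalRealSubfield L)) L (IsCMField.complexConj L) 3 (Matrix.diagonal α)) : GL (Fin 3) (mixedSpace L)) : Matrix (Fin 3) (Fin 3) (mixedSpace L))
              ∂(Measure.pi (Function.update μall w (m))) =
      ∫ x : archLocal L 3 (Matrix.diagonal α) w, Θ' ((x : GL (Fin 3) ℂ) : Matrix (Fin 3) (Fin 3) ℂ) ∂m := by
  haveI : ∀ v, IsFiniteMeasureOnCompacts (Function.update μall w m v) := isFiniteMeasureOnCompacts_update μall w m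
  haveI : ∀ v, SigmaFinite (Function.update μall w m v) := sigmaFinite_update μall w m
  rw [integral_pi_eq_integral_mixedPartial L 3 α w (Function.update μall w m) Θ hΘ hΘc]
  simp only [update_apply_coe_of_ne, Function.update_self]
  exact integral_congr_ae (ae_of_all _ fun x => (hΘ'eq x).symm)

open scoped Classical in
/-- **STATE WITH A PROPER REGULAR ORBIT MEASURE AT `w`**: for `d ∈ G_w` with proper orbit map (regular points ★, compact walls ★ p840971 §3),
`I(μ[w ↦ ν.map (y ↦ y·d·y⁻¹)]) = ∫ Θ′ ↑↑(y·d·y⁻¹) dν(y)`. [cite: Rogawski1990, §8.3 p. 122] [cite: BorelJacquet1979, §4.1] -/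
theorem integral_pi_update_map_conj_eq_integral
    [MeasurableSpace (arch (↥(maximalRealSubfield L)) L (IsCMField.complexConj L) 3 (Matrix.diagonal α))] [BorelSpace (arch (↥(maximalRealSubfield L)) L (IsCMField.complexConj L) 3 (Matrix.diagonal α))]
    (μall : ∀ v : {w : InfinitePlace L // IsComplex w}, Measure (archLocal L 3 (Matrix.diagonal α) v)) [∀ v, IsFiniteMeasureOnCompacts (μall v)] [∀ v, SigmaFinite (μall v)]
    (ν : Measure (archLocal L 3 (Matrix.diagonal α) w)) [IsFiniteMeasureOnCompacts ν] (d : archLocal L 3 (Matrix.diagonal α) w)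
    (hprop : ∀ C : Set (archLocal L 3 (Matrix.diagonal α) w), IsCompact C → IsCompact {g : archLocal L 3 (Matrix.diagonal α) w | g * d * g⁻¹ ∈ C})
    (Θ : Matrix (Fin 3) (Fin 3) (mixedSpace L) → ℂ) (hΘ : Continuous Θ)
    (hΘc : HasCompactSupport fun g : arch (↥(maximalRealSubfield L)) L (IsCMField.complexConj L) 3 (Matrix.diagonal α) => Θ ((g : GL (Fin 3) (mixedSpace L)) : Matrix (Fin 3) (Fin 3) (mixedSpace L)))
    (Θ' : Matrix (Fin 3) (Fin 3) ℂ → ℂ) (hΘ' : Continuous Θ')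
    (hΘ'eq : ∀ x : archLocal L 3 (Matrix.diagonal α) w, Θ' ((x : GL (Fin 3) ℂ) : Matrix (Fin 3) (Fin 3) ℂ) = ∫ o' : (∀ w' : {v : {w : InfinitePlace L // IsComplex w} // ¬ v = w}, archLocal L 3 (Matrix.diagonal α) w'.1),
          Θ ((((archPiEquivCM 3 L (Matrix.diagonal α)).symm
            ((MeasurableEquiv.piEquivPiSubtypeProd (fun v : {w : InfinitePlace L // IsComplex w} => ↥(archLocal L 3 (Matrix.diagonal α) v)) (· = w)).symm
              ((MeasurableEquiv.piUnique fun i : {v : {w : InfinitePlace L // IsComplex w} // v = w} => ↥(archLocal L 3 (Matrix.diagonal α) i.1)).symm x, o')) : arch (↥(maximalRealSubfield L)) L (IsCMField.complexConj L) 3 (Matrix.diagonal α)) :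
            GL (Fin 3) (mixedSpace L)) : Matrix (Fin 3) (Fin 3) (mixedSpace L)) ∂(Measure.pi fun w' : {v : {w : InfinitePlace L // IsComplex w} // ¬ v = w} => μall w'.1)) :
    ∫ o, Θ ((((archPiEquivCM 3 L (Matrix.diagonal α)).symm o : arch (↥(maximalRealSubfield L)) L (IsCMField.complexConj L) 3 (Matrix.diagonal α)) : GL (Fin 3) (mixedSpace L)) : Matrix (Fin 3) (Fin 3) (mixedSpace L))
              ∂(Measure.pi (Function.update μall w (ν.map fun y : archLocal L 3 (Matrix.diagonal α) w => y * d * y⁻¹))) =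
      ∫ y : archLocal L 3 (Matrix.diagonal α) w, Θ' (((y * d * y⁻¹ : archLocal L 3 (Matrix.diagonal α) w) : GL (Fin 3) ℂ) : Matrix (Fin 3) (Fin 3) ℂ) ∂ν := by
  haveI : LocallyCompactSpace (archLocal L 3 (Matrix.diagonal α) w) := locallyCompactSpace_archLocal L 3 (Matrix.diagonal α) w
  haveI : SecondCountableTopology (archLocal L 3 (Matrix.diagonal α) w) := secondCountableTopology_archLocal L 3 (Matrix.diagonal α) w
  haveI := isFiniteMeasureOnCompacts_map_conj_of_proper L 3 α w ν d hprop
  have hm : Measurable fun y : archLocal L 3 (Matrix.diagonal α) w => y * d * y⁻¹ := ((continuous_id.mul continuous_const).mul continuous_id.inv).measurable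
  have hcont : Continuous fun x : archLocal L 3 (Matrix.diagonal α) w => Θ' ((x : GL (Fin 3) ℂ) : Matrix (Fin 3) (Fin 3) ℂ) :=
    hΘ'.comp (Units.continuous_val.comp continuous_subtype_val)
  rw [integral_pi_update_eq_integral_of_eq_mixedPartial L α w μall _ Θ hΘ hΘc Θ' hΘ'eq, integral_map hm.aemeasurable hcont.aestronglyMeasurable]

open scoped Classical in
/-- **STATE WITH A SINGULAR ORBIT MEASURE AT `w`**: for the wall point `diag z₀` relabelled by `τ` and its J1 data (`νH` on `Z(diag z₁) ≤ G_w(α∘τ)`), the state against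
`μ^{sing}_τ := ((quotientMeasure Z νH _ (ν.map e_τ⁻¹)).map (orbit map)).map e_τ` is J1's singular term at `Θ′`: `= ∫ descConj (diag z₀) Z _ (k ↦ Θ′(M_τ ↑↑k M_τ⁻¹)) d(quotientMeasure …)`
(★ (R1-f) along `e_τ`; closed split-semisimple class ★; `Z(diag z₁) = Z(diag z₀)` on the wall ★; ★ `apply_coe_relabel`). [cite: Rogawski1990, §8.2 p. 123] [cite: DeitmarEchterhoff2014, Lemma 9.3.3] -/
theorem integral_pi_update_singularOrbitMeasure_eq_integral_descConj
    [MeasurableSpace (arch (↥(maximalRealSubfield L)) L (IsCMField.complexConj L) 3 (Matrix.diagonal α))] [BorelSpace (arch (↥(maximalRealSubfield L)) L (IsCMField.complexConj L) 3 (Matrix.diagonal α))]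
    (hα : ∀ i, α i ≠ 0) (hherm : ∀ i, (IsCMField.complexConj L (α i) : L) = α i)
    (μall : ∀ v : {w : InfinitePlace L // IsComplex w}, Measure (archLocal L 3 (Matrix.diagonal α) v)) [∀ v, IsFiniteMeasureOnCompacts (μall v)] [∀ v, SigmaFinite (μall v)]
    (ν : Measure (archLocal L 3 (Matrix.diagonal α) w)) [ν.IsHaarMeasure] [ν.IsMulRightInvariant] (τ : Perm (Fin 3))
    (z₁ : Fin 3 → Circle) (h02 : z₁ 0 = z₁ 2) (h01 : z₁ 0 ≠ z₁ 1) (z₀ : Fin 3 → Circle) (h02' : z₀ 0 = z₀ 2) (h01' : z₀ 0 ≠ z₀ 1)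
    [MeasurableSpace (archLocal L 3 (Matrix.diagonal (α ∘ ⇑τ)) w ⧸ Subgroup.centralizer
      ({(⟨circleDiagonal 3 z₁, circleDiagonal_mem_archLocal_diagonal L 3 (α ∘ ⇑τ) w z₁⟩ : archLocal L 3 (Matrix.diagonal (α ∘ ⇑τ)) w)} :
        Set (archLocal L 3 (Matrix.diagonal (α ∘ ⇑τ)) w)))]
    [BorelSpace (archLocal L 3 (Matrix.diagonal (α ∘ ⇑τ)) w ⧸ Subgroup.centralizer
      ({(⟨circleDiagonal 3 z₁, circleDiagonal_mem_archLocal_diagonal L 3 (α ∘ ⇑τ) w z₁⟩ : archLocal L 3 (Matrix.diagonal (α ∘ ⇑τ)) w)} :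
        Set (archLocal L 3 (Matrix.diagonal (α ∘ ⇑τ)) w)))]
    (νHτ : Measure (Subgroup.centralizer
      ({(⟨circleDiagonal 3 z₁, circleDiagonal_mem_archLocal_diagonal L 3 (α ∘ ⇑τ) w z₁⟩ : archLocal L 3 (Matrix.diagonal (α ∘ ⇑τ)) w)} :
        Set (archLocal L 3 (Matrix.diagonal (α ∘ ⇑τ)) w)))) [νHτ.IsHaarMeasure] [νHτ.IsInvInvariant]
    (Θ : Matrix (Fin 3) (Fin 3) (mixedSpace L) → ℂ) (hΘ : Continuous Θ)
    (hΘc : HasCompactSupport fun g : arch (↥(maximalRealSubfield L)) L (IsCMField.complexConj L) 3 (Matrix.diagonal α) => Θ ((g : GL (Fin 3) (mixedSpace L)) : Matrix (Fin 3) (Fin 3) (mixedSpace L)))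
    (Θ' : Matrix (Fin 3) (Fin 3) ℂ → ℂ) (hΘ' : Continuous Θ')
    (hΘ'eq : ∀ x : archLocal L 3 (Matrix.diagonal α) w, Θ' ((x : GL (Fin 3) ℂ) : Matrix (Fin 3) (Fin 3) ℂ) = ∫ o' : (∀ w' : {v : {w : InfinitePlace L // IsComplex w} // ¬ v = w}, archLocal L 3 (Matrix.diagonal α) w'.1),
          Θ ((((archPiEquivCM 3 L (Matrix.diagonal α)).symm
            ((MeasurableEquiv.piEquivPiSubtypeProd (fun v : {w : InfinitePlace L // IsComplex w} => ↥(archLocal L 3 (Matrix.diagonal α) v)) (· = w)).symm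
              ((MeasurableEquiv.piUnique fun i : {v : {w : InfinitePlace L // IsComplex w} // v = w} => ↥(archLocal L 3 (Matrix.diagonal α) i.1)).symm x, o')) : arch (↥(maximalRealSubfield L)) L (IsCMField.complexConj L) 3 (Matrix.diagonal α)) :
            GL (Fin 3) (mixedSpace L)) : Matrix (Fin 3) (Fin 3) (mixedSpace L)) ∂(Measure.pi fun w' : {v : {w : InfinitePlace L // IsComplex w} // ¬ v = w} => μall w'.1)) :
    haveI : LocallyCompactSpace (archLocal L 3 (Matrix.diagonal (α ∘ ⇑τ)) w) := locallyCompactSpace_archLocal L 3 (Matrix.diagonal (α ∘ ⇑τ)) w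
    haveI : SecondCountableTopology (archLocal L 3 (Matrix.diagonal (α ∘ ⇑τ)) w) := secondCountableTopology_archLocal L 3 (Matrix.diagonal (α ∘ ⇑τ)) w
    haveI : (ν.map (ContinuousMulEquiv.restrictSubgroup (GLn.conjEquiv (Matrix.GeneralLinearGroup.mkOfDetNeZero _ (det_monomial_one_ne_zero 3 τ)))
            (archLocal L 3 (Matrix.diagonal (α ∘ ⇑τ)) w) (archLocal L 3 (Matrix.diagonal α) w)
            (mem_archLocal_comp_perm_iff_conj_mem L 3 α w τ)).symm).IsMulRightInvariant := isMulRightInvariant_map_relabel_symm L 3 α w τ ν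
    haveI : (ν.map (ContinuousMulEquiv.restrictSubgroup (GLn.conjEquiv (Matrix.GeneralLinearGroup.mkOfDetNeZero _ (det_monomial_one_ne_zero 3 τ)))
            (archLocal L 3 (Matrix.diagonal (α ∘ ⇑τ)) w) (archLocal L 3 (Matrix.diagonal α) w)
            (mem_archLocal_comp_perm_iff_conj_mem L 3 α w τ)).symm).IsHaarMeasure := ContinuousMulEquiv.isHaarMeasure_map ν _
    ∫ o, Θ ((((archPiEquivCM 3 L (Matrix.diagonal α)).symm o : arch (↥(maximalRealSubfield L)) L (IsCMField.complexConj L) 3 (Matrix.diagonal α)) : GL (Fin 3) (mixedSpace L)) : Matrix (Fin 3) (Fin 3) (mixedSpace L))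
              ∂(Measure.pi (Function.update μall w (((quotientMeasure _ (νHτ) (isClosed_coe_centralizer_singleton _) (ν.map (ContinuousMulEquiv.restrictSubgroup (GLn.conjEquiv (Matrix.GeneralLinearGroup.mkOfDetNeZero _ (det_monomial_one_ne_zero 3 τ)))
            (archLocal L 3 (Matrix.diagonal (α ∘ ⇑τ)) w) (archLocal L 3 (Matrix.diagonal α) w)
            (mem_archLocal_comp_perm_iff_conj_mem L 3 α w τ)).symm)).map
                (descConj (⟨circleDiagonal 3 z₀, circleDiagonal_mem_archLocal_diagonal L 3 (α ∘ ⇑τ) w z₀⟩ : archLocal L 3 (Matrix.diagonal (α ∘ ⇑τ)) w)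
                  (Subgroup.centralizer ({(⟨circleDiagonal 3 z₁, circleDiagonal_mem_archLocal_diagonal L 3 (α ∘ ⇑τ) w z₁⟩ :
                    archLocal L 3 (Matrix.diagonal (α ∘ ⇑τ)) w)} : Set (archLocal L 3 (Matrix.diagonal (α ∘ ⇑τ)) w)))
                  (forall_mem_centralizer_circleDiagonal_comm_of_wall L (α ∘ ⇑τ) w h02 h01 h02' h01') id)).map
                (ContinuousMulEquiv.restrictSubgroup (GLn.conjEquiv (Matrix.GeneralLinearGroup.mkOfDetNeZero _ (det_monomial_one_ne_zero 3 τ)))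
            (archLocal L 3 (Matrix.diagonal (α ∘ ⇑τ)) w) (archLocal L 3 (Matrix.diagonal α) w)
            (mem_archLocal_comp_perm_iff_conj_mem L 3 α w τ))))) =
      ∫ y, descConj (⟨circleDiagonal 3 z₀, circleDiagonal_mem_archLocal_diagonal L 3 (α ∘ ⇑τ) w z₀⟩ : archLocal L 3 (Matrix.diagonal (α ∘ ⇑τ)) w)
          (Subgroup.centralizer ({(⟨circleDiagonal 3 z₁, circleDiagonal_mem_archLocal_diagonal L 3 (α ∘ ⇑τ) w z₁⟩ :
            archLocal L 3 (Matrix.diagonal (α ∘ ⇑τ)) w)} : Set (archLocal L 3 (Matrix.diagonal (α ∘ ⇑τ)) w)))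
          (forall_mem_centralizer_circleDiagonal_comm_of_wall L (α ∘ ⇑τ) w h02 h01 h02' h01')
          (fun k : archLocal L 3 (Matrix.diagonal (α ∘ ⇑τ)) w =>
            Θ' ((monomial τ fun _ : Fin 3 => (1 : ℂ)) * ((k : GL (Fin 3) ℂ) : Matrix (Fin 3) (Fin 3) ℂ) *
              (((Matrix.GeneralLinearGroup.mkOfDetNeZero _ (det_monomial_one_ne_zero 3 τ))⁻¹ : GL (Fin 3) ℂ) : Matrix (Fin 3) (Fin 3) ℂ))) y
          ∂(quotientMeasure _ νHτ (isClosed_coe_centralizer_singleton _) (ν.map (ContinuousMulEquiv.restrictSubgroup (GLn.conjEquiv (Matrix.GeneralLinearGroup.mkOfDetNeZero _ (det_monomial_one_ne_zero 3 τ)))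
            (archLocal L 3 (Matrix.diagonal (α ∘ ⇑τ)) w) (archLocal L 3 (Matrix.diagonal α) w)
            (mem_archLocal_comp_perm_iff_conj_mem L 3 α w τ)).symm)) := by
  haveI hLCτ : LocallyCompactSpace (archLocal L 3 (Matrix.diagonal (α ∘ ⇑τ)) w) := locallyCompactSpace_archLocal L 3 (Matrix.diagonal (α ∘ ⇑τ)) w
  haveI hSCτ : SecondCountableTopology (archLocal L 3 (Matrix.diagonal (α ∘ ⇑τ)) w) := secondCountableTopology_archLocal L 3 (Matrix.diagonal (α ∘ ⇑τ)) w
  haveI : LocallyCompactSpace (archLocal L 3 (Matrix.diagonal α) w) := locallyCompactSpace_archLocal L 3 (Matrix.diagonal α) w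
  haveI : SecondCountableTopology (archLocal L 3 (Matrix.diagonal α) w) := secondCountableTopology_archLocal L 3 (Matrix.diagonal α) w
  haveI hRI : (ν.map (ContinuousMulEquiv.restrictSubgroup (GLn.conjEquiv (Matrix.GeneralLinearGroup.mkOfDetNeZero _ (det_monomial_one_ne_zero 3 τ)))
            (archLocal L 3 (Matrix.diagonal (α ∘ ⇑τ)) w) (archLocal L 3 (Matrix.diagonal α) w)
            (mem_archLocal_comp_perm_iff_conj_mem L 3 α w τ)).symm).IsMulRightInvariant := isMulRightInvariant_map_relabel_symm L 3 α w τ ν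
  haveI hHM : (ν.map (ContinuousMulEquiv.restrictSubgroup (GLn.conjEquiv (Matrix.GeneralLinearGroup.mkOfDetNeZero _ (det_monomial_one_ne_zero 3 τ)))
            (archLocal L 3 (Matrix.diagonal (α ∘ ⇑τ)) w) (archLocal L 3 (Matrix.diagonal α) w)
            (mem_archLocal_comp_perm_iff_conj_mem L 3 α w τ)).symm).IsHaarMeasure := ContinuousMulEquiv.isHaarMeasure_map ν _
  -- the class of `diag z₀` in `G_w(α∘τ)` is closed (split semisimple) and `Z(diag z₁) = Z(diag z₀)` on the wall ⇒ the singular orbit measure is Radon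
  have hdet : (Matrix.diagonal (α ∘ ⇑τ)).det ≠ 0 := by
    rw [Matrix.det_diagonal]; exact Finset.prod_ne_zero_iff.mpr fun i _ => hα _
  have hab : ((z₀ 0 : Circle) : ℂ) ≠ z₀ 1 := fun h => h01' (Subtype.val_injective h)
  have hO := isClosed_conjClass_archLocal_of_mul_sub_eq_zero L 3 (Matrix.diagonal (α ∘ ⇑τ)) w
    (map_cmConjRingHom_transpose_diagonal L (α ∘ ⇑τ) fun i => hherm _) hdet
    (⟨circleDiagonal 3 z₀, circleDiagonal_mem_archLocal_diagonal L 3 (α ∘ ⇑τ) w z₀⟩ : archLocal L 3 (Matrix.diagonal (α ∘ ⇑τ)) w)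
    hab (mul_sub_eq_zero_circleDiagonal_wall L (α ∘ ⇑τ) w h02')
  have hMeq := centralizer_circleDiagonal_eq_of_wall L (α ∘ ⇑τ) w h02 h01 h02' h01'
  haveI := isFiniteMeasureOnCompacts_map_map_descConj_id _ _
    (forall_mem_centralizer_circleDiagonal_comm_of_wall L (α ∘ ⇑τ) w h02 h01 h02' h01') hO hMeq
    (quotientMeasure _ νHτ (isClosed_coe_centralizer_singleton _) (ν.map (ContinuousMulEquiv.restrictSubgroup (GLn.conjEquiv (Matrix.GeneralLinearGroup.mkOfDetNeZero _ (det_monomial_one_ne_zero 3 τ)))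
            (archLocal L 3 (Matrix.diagonal (α ∘ ⇑τ)) w) (archLocal L 3 (Matrix.diagonal α) w)
            (mem_archLocal_comp_perm_iff_conj_mem L 3 α w τ)).symm)) (ContinuousMulEquiv.restrictSubgroup (GLn.conjEquiv (Matrix.GeneralLinearGroup.mkOfDetNeZero _ (det_monomial_one_ne_zero 3 τ)))
            (archLocal L 3 (Matrix.diagonal (α ∘ ⇑τ)) w) (archLocal L 3 (Matrix.diagonal α) w)
            (mem_archLocal_comp_perm_iff_conj_mem L 3 α w τ))
  have hcont : Continuous fun x : archLocal L 3 (Matrix.diagonal α) w => Θ' ((x : GL (Fin 3) ℂ) : Matrix (Fin 3) (Fin 3) ℂ) :=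
    hΘ'.comp (Units.continuous_val.comp continuous_subtype_val)
  rw [integral_pi_update_eq_integral_of_eq_mixedPartial L α w μall _ Θ hΘ hΘc Θ' hΘ'eq,
    ← integral_descConj_comp_equiv_eq_integral_map_map _ _ _ _ (ContinuousMulEquiv.restrictSubgroup (GLn.conjEquiv (Matrix.GeneralLinearGroup.mkOfDetNeZero _ (det_monomial_one_ne_zero 3 τ)))
            (archLocal L 3 (Matrix.diagonal (α ∘ ⇑τ)) w) (archLocal L 3 (Matrix.diagonal α) w)
            (mem_archLocal_comp_perm_iff_conj_mem L 3 α w τ)) _ hcont]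
  simp only [apply_coe_relabel]

/-! ## §3 The one-step jump at `w` in all-places orbit-measure currency (N = 3, CM `L`, unconditional) -/

open scoped Classical in
/-- **(R1-e′) THE ONE-STEP JUMP AT `w`, ORBIT-MEASURE CURRENCY.**  For a CM field `L`, weights `α`, a place `w`, a Haar measure `ν` on `G_w(α)`, J1's auxiliary wall point `z₁`
and centraliser measures `νH τ`: there are constants `c τ ≠ 0` (noncompact walls) such that for every global test function `Θ`, every family `μ = (μ_v)_v` of Radon measures on the
`G_v`, and every wall point `z₀` (`z₀ 0 = z₀ 2 ≠ z₀ 1`):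
`∂_ψ [2 sin ψ · Σ_ρ I(μ[w ↦ ν.map (y ↦ y·diag(γ_{z₀}(ψ)∘ρ)·y⁻¹)])] ⟶ Σ_ρ (compact: 2 · I(μ[w ↦ ν.map (y ↦ y·diag(z₀∘ρ)·y⁻¹)]) ∣ noncompact: c_{ρ⁻¹} · I(μ[w ↦ μ^{sing}_ρ]))`
as `ψ → 0+`, `I(μ′) = ∫ Θ ↑↑(e⁻¹ o) d(⊗_v μ′_v)` (J1 ★ p840906 at the mixed partial test function ★ p841031, regular terms reassembled by ★ p841084, singular terms by ★ (R1-f)).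
[cite: Rogawski1990, §8.2 p. 124; §14.5 p. 238] [cite: Varadarajan1989, §6.4 Thm 22] [cite: BorelJacquet1979, §4.1] [cite: DeitmarEchterhoff2014, Lemma 9.3.3] -/
theorem exists_tendsto_deriv_sin_mul_sum_integral_pi_update_splitCurve
    (hα : ∀ i, α i ≠ 0) (hherm : ∀ i, (IsCMField.complexConj L (α i) : L) = α i)
    (ν : Measure (archLocal L 3 (Matrix.diagonal α) w)) [ν.IsHaarMeasure] [ν.IsMulRightInvariant]
    (z₁ : Fin 3 → Circle) (h02 : z₁ 0 = z₁ 2) (h01 : z₁ 0 ≠ z₁ 1)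
    [∀ τ : Perm (Fin 3), MeasurableSpace (archLocal L 3 (Matrix.diagonal (α ∘ ⇑τ)) w ⧸ Subgroup.centralizer
      ({(⟨circleDiagonal 3 z₁, circleDiagonal_mem_archLocal_diagonal L 3 (α ∘ ⇑τ) w z₁⟩ : archLocal L 3 (Matrix.diagonal (α ∘ ⇑τ)) w)} :
        Set (archLocal L 3 (Matrix.diagonal (α ∘ ⇑τ)) w)))]
    [∀ τ : Perm (Fin 3), BorelSpace (archLocal L 3 (Matrix.diagonal (α ∘ ⇑τ)) w ⧸ Subgroup.centralizer
      ({(⟨circleDiagonal 3 z₁, circleDiagonal_mem_archLocal_diagonal L 3 (α ∘ ⇑τ) w z₁⟩ : archLocal L 3 (Matrix.diagonal (α ∘ ⇑τ)) w)} :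
        Set (archLocal L 3 (Matrix.diagonal (α ∘ ⇑τ)) w)))]
    (νH : ∀ τ : Perm (Fin 3), Measure (Subgroup.centralizer
      ({(⟨circleDiagonal 3 z₁, circleDiagonal_mem_archLocal_diagonal L 3 (α ∘ ⇑τ) w z₁⟩ : archLocal L 3 (Matrix.diagonal (α ∘ ⇑τ)) w)} :
        Set (archLocal L 3 (Matrix.diagonal (α ∘ ⇑τ)) w))))
    [∀ τ, (νH τ).IsHaarMeasure] [∀ τ, (νH τ).IsInvInvariant]
    [MeasurableSpace (arch (↥(maximalRealSubfield L)) L (IsCMField.complexConj L) 3 (Matrix.diagonal α))] [BorelSpace (arch (↥(maximalRealSubfield L)) L (IsCMField.complexConj L) 3 (Matrix.diagonal α))] :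
    haveI : ∀ τ : Perm (Fin 3), LocallyCompactSpace (archLocal L 3 (Matrix.diagonal (α ∘ ⇑τ)) w) := fun τ => locallyCompactSpace_archLocal L 3 (Matrix.diagonal (α ∘ ⇑τ)) w
    haveI : ∀ τ : Perm (Fin 3), SecondCountableTopology (archLocal L 3 (Matrix.diagonal (α ∘ ⇑τ)) w) := fun τ => secondCountableTopology_archLocal L 3 (Matrix.diagonal (α ∘ ⇑τ)) w
    haveI : ∀ τ : Perm (Fin 3), (ν.map (ContinuousMulEquiv.restrictSubgroup (GLn.conjEquiv (Matrix.GeneralLinearGroup.mkOfDetNeZero _ (det_monomial_one_ne_zero 3 τ)))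
            (archLocal L 3 (Matrix.diagonal (α ∘ ⇑τ)) w) (archLocal L 3 (Matrix.diagonal α) w)
            (mem_archLocal_comp_perm_iff_conj_mem L 3 α w τ)).symm).IsMulRightInvariant := fun τ => isMulRightInvariant_map_relabel_symm L 3 α w τ ν
    haveI : ∀ τ : Perm (Fin 3), (ν.map (ContinuousMulEquiv.restrictSubgroup (GLn.conjEquiv (Matrix.GeneralLinearGroup.mkOfDetNeZero _ (det_monomial_one_ne_zero 3 τ)))
            (archLocal L 3 (Matrix.diagonal (α ∘ ⇑τ)) w) (archLocal L 3 (Matrix.diagonal α) w)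
            (mem_archLocal_comp_perm_iff_conj_mem L 3 α w τ)).symm).IsHaarMeasure := fun _ => ContinuousMulEquiv.isHaarMeasure_map ν _
    ∃ c : Perm (Fin 3) → ℂ,
      (∀ τ : Perm (Fin 3), (w.1.embedding (α (τ 0))).re * (w.1.embedding (α (τ 2))).re < 0 → c τ ≠ 0) ∧
      ∀ (Θ : Matrix (Fin 3) (Fin 3) (mixedSpace L) → ℂ), ContDiff ℝ (⊤ : ℕ∞) Θ →
        HasCompactSupport (fun g : arch (↥(maximalRealSubfield L)) L (IsCMField.complexConj L) 3 (Matrix.diagonal α) => Θ ((g : GL (Fin 3) (mixedSpace L)) : Matrix (Fin 3) (Fin 3) (mixedSpace L))) →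
        ∀ (μall : ∀ v : {w : InfinitePlace L // IsComplex w}, Measure (archLocal L 3 (Matrix.diagonal α) v)) [∀ v, IsFiniteMeasureOnCompacts (μall v)] [∀ v, SigmaFinite (μall v)],
        ∀ (z₀ : Fin 3 → Circle) (h02' : z₀ 0 = z₀ 2) (h01' : z₀ 0 ≠ z₀ 1),
          Tendsto (fun ψ : ℝ => deriv (fun ψ : ℝ => (2 * Real.sin ψ : ℂ) * ∑ ρ : Perm (Fin 3),
              ∫ o, Θ ((((archPiEquivCM 3 L (Matrix.diagonal α)).symm o : arch (↥(maximalRealSubfield L)) L (IsCMField.complexConj L) 3 (Matrix.diagonal α)) : GL (Fin 3) (mixedSpace L)) : Matrix (Fin 3) (Fin 3) (mixedSpace L))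
              ∂(Measure.pi (Function.update μall w (ν.map fun y : archLocal L 3 (Matrix.diagonal α) w => y * (⟨circleDiagonal 3 ((fun i => z₀ i * Circle.exp (![(1 : ℝ), 0, -1] i * ψ)) ∘ ⇑ρ), circleDiagonal_mem_archLocal_diagonal L 3 α w ((fun i => z₀ i * Circle.exp (![(1 : ℝ), 0, -1] i * ψ)) ∘ ⇑ρ)⟩ : archLocal L 3 (Matrix.diagonal α) w) * y⁻¹)))) ψ)
            (𝓝[>] 0)
            (𝓝 (∑ ρ : Perm (Fin 3),
              if 0 < (w.1.embedding (α (ρ⁻¹ 0))).re * (w.1.embedding (α (ρ⁻¹ 2))).re then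
                2 * ∫ o, Θ ((((archPiEquivCM 3 L (Matrix.diagonal α)).symm o : arch (↥(maximalRealSubfield L)) L (IsCMField.complexConj L) 3 (Matrix.diagonal α)) : GL (Fin 3) (mixedSpace L)) : Matrix (Fin 3) (Fin 3) (mixedSpace L))
              ∂(Measure.pi (Function.update μall w (ν.map fun y : archLocal L 3 (Matrix.diagonal α) w => y * (⟨circleDiagonal 3 (z₀ ∘ ⇑ρ), circleDiagonal_mem_archLocal_diagonal L 3 α w (z₀ ∘ ⇑ρ)⟩ : archLocal L 3 (Matrix.diagonal α) w) * y⁻¹)))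
              else
                c ρ⁻¹ * ∫ o, Θ ((((archPiEquivCM 3 L (Matrix.diagonal α)).symm o : arch (↥(maximalRealSubfield L)) L (IsCMField.complexConj L) 3 (Matrix.diagonal α)) : GL (Fin 3) (mixedSpace L)) : Matrix (Fin 3) (Fin 3) (mixedSpace L))
              ∂(Measure.pi (Function.update μall w (((quotientMeasure _ (νH ρ⁻¹) (isClosed_coe_centralizer_singleton _) (ν.map (ContinuousMulEquiv.restrictSubgroup (GLn.conjEquiv (Matrix.GeneralLinearGroup.mkOfDetNeZero _ (det_monomial_one_ne_zero 3 ρ⁻¹)))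
            (archLocal L 3 (Matrix.diagonal (α ∘ ⇑ρ⁻¹)) w) (archLocal L 3 (Matrix.diagonal α) w)
            (mem_archLocal_comp_perm_iff_conj_mem L 3 α w ρ⁻¹)).symm)).map
                (descConj (⟨circleDiagonal 3 z₀, circleDiagonal_mem_archLocal_diagonal L 3 (α ∘ ⇑ρ⁻¹) w z₀⟩ : archLocal L 3 (Matrix.diagonal (α ∘ ⇑ρ⁻¹)) w)
                  (Subgroup.centralizer ({(⟨circleDiagonal 3 z₁, circleDiagonal_mem_archLocal_diagonal L 3 (α ∘ ⇑ρ⁻¹) w z₁⟩ :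
                    archLocal L 3 (Matrix.diagonal (α ∘ ⇑ρ⁻¹)) w)} : Set (archLocal L 3 (Matrix.diagonal (α ∘ ⇑ρ⁻¹)) w)))
                  (forall_mem_centralizer_circleDiagonal_comm_of_wall L (α ∘ ⇑ρ⁻¹) w h02 h01 h02' h01') id)).map
                (ContinuousMulEquiv.restrictSubgroup (GLn.conjEquiv (Matrix.GeneralLinearGroup.mkOfDetNeZero _ (det_monomial_one_ne_zero 3 ρ⁻¹)))
            (archLocal L 3 (Matrix.diagonal (α ∘ ⇑ρ⁻¹)) w) (archLocal L 3 (Matrix.diagonal α) w)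
            (mem_archLocal_comp_perm_iff_conj_mem L 3 α w ρ⁻¹))))))) := by
  classical
  haveI hLC : ∀ τ : Perm (Fin 3), LocallyCompactSpace (archLocal L 3 (Matrix.diagonal (α ∘ ⇑τ)) w) :=
    fun τ => locallyCompactSpace_archLocal L 3 (Matrix.diagonal (α ∘ ⇑τ)) w
  haveI hSC : ∀ τ : Perm (Fin 3), SecondCountableTopology (archLocal L 3 (Matrix.diagonal (α ∘ ⇑τ)) w) :=
    fun τ => secondCountableTopology_archLocal L 3 (Matrix.diagonal (α ∘ ⇑τ)) w
  haveI hLCv : ∀ v : {w : InfinitePlace L // IsComplex w}, LocallyCompactSpace (archLocal L 3 (Matrix.diagonal α) v) := fun v => locallyCompactSpace_archLocal L 3 (Matrix.diagonal α) v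
  haveI hSCv : ∀ v : {w : InfinitePlace L // IsComplex w}, SecondCountableTopology (archLocal L 3 (Matrix.diagonal α) v) := fun v => secondCountableTopology_archLocal L 3 (Matrix.diagonal α) v
  have hreal : ∀ i, (w.1.embedding (α i)).im = 0 := fun i => im_embedding_eq_zero_of_complexConj_eq L w (hherm i)
  obtain ⟨c, hc, hJ1⟩ := exists_tendsto_deriv_sin_mul_sum_integral_comp_conj_splitCurve_comp_perm_of_isCMField L α w hα hreal ν z₁ h02 h01 νH
  refine ⟨c, hc, fun Θ hΘ hΘc μall _ _ z₀ h02' h01' => ?_⟩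
  -- the mixed partial integral over the places `v ≠ w` is the restriction of a per-place test function `Θ'` (★ (R1-a))
  obtain ⟨Θ', hΘ'd, hΘ'c, hΘ'eq⟩ := exists_contDiff_eq_integral_insert L 3 α hα w (fun w' : {v : {w : InfinitePlace L // IsComplex w} // ¬ v = w} => μall w'.1) Θ hΘ hΘc
  -- (D) the regularity window at `w`
  obtain ⟨ε, hε, hregε⟩ : ∃ ε > 0, ∀ ψ : ℝ, 0 < ψ → ψ < ε → ∀ ρ : Perm (Fin 3),
      Function.Injective ((fun i => z₀ i * Circle.exp (![(1 : ℝ), 0, -1] i * ψ)) ∘ ⇑ρ) := by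
    have h := (eventually_injective_splitCurve z₀ h02' h01').filter_mono (nhdsWithin_mono _ fun x (hx : 0 < x) => ne_of_gt hx)
    rw [eventually_nhdsWithin_iff, Metric.eventually_nhds_iff] at h
    obtain ⟨ε, hε, h⟩ := h
    exact ⟨ε, hε, fun ψ h0 hψε ρ => (h (by rw [Real.dist_eq, sub_zero, abs_of_pos h0]; exact hψε) h0).comp ρ.injective⟩
  -- (E) on the window the state is J1's function at `Θ'`
  have hpt : ∀ ψ : ℝ, 0 < ψ → ψ < ε →
      (fun ψ : ℝ => (2 * Real.sin ψ : ℂ) * ∑ ρ : Perm (Fin 3),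
        ∫ o, Θ ((((archPiEquivCM 3 L (Matrix.diagonal α)).symm o : arch (↥(maximalRealSubfield L)) L (IsCMField.complexConj L) 3 (Matrix.diagonal α)) :
            GL (Fin 3) (mixedSpace L)) : Matrix (Fin 3) (Fin 3) (mixedSpace L))
          ∂(Measure.pi (Function.update μall w (ν.map fun y : archLocal L 3 (Matrix.diagonal α) w =>
            y * (⟨circleDiagonal 3 ((fun i => z₀ i * Circle.exp (![(1 : ℝ), 0, -1] i * ψ)) ∘ ⇑ρ), circleDiagonal_mem_archLocal_diagonal L 3 α w ((fun i => z₀ i * Circle.exp (![(1 : ℝ), 0, -1] i * ψ)) ∘ ⇑ρ)⟩ : archLocal L 3 (Matrix.diagonal α) w) * y⁻¹)))) ψ =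
      (fun ψ : ℝ => (2 * Real.sin ψ : ℂ) * ∑ ρ : Perm (Fin 3), ∫ g : archLocal L 3 (Matrix.diagonal α) w,
        Θ' ((((g * ⟨circleDiagonal 3 ((fun i => z₀ i * Circle.exp (![(1 : ℝ), 0, -1] i * ψ)) ∘ ⇑ρ), circleDiagonal_mem_archLocal_diagonal L 3 α w _⟩ * g⁻¹ :
          archLocal L 3 (Matrix.diagonal α) w) : GL (Fin 3) ℂ) : Matrix (Fin 3) (Fin 3) ℂ)) ∂ν) ψ := by
    intro ψ h0 hψε
    simp only []
    congr 1
    refine Finset.sum_congr rfl fun ρ _ => integral_pi_update_map_conj_eq_integral L α w μall ν _ (fun C hC => ?_) Θ hΘ.continuous hΘc Θ' hΘ'd.continuous hΘ'eq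
    exact isCompact_setOf_conj_circleDiagonal_mem_of_injective L 3 α w hα _ (hregε ψ h0 hψε ρ) C hC
  -- (F) hence the derivatives agree near `0+`, and J1's limit transfers
  have hev : ∀ᶠ ψ in 𝓝[>] (0 : ℝ),
      deriv (fun ψ : ℝ => (2 * Real.sin ψ : ℂ) * ∑ ρ : Perm (Fin 3), ∫ g : archLocal L 3 (Matrix.diagonal α) w,
        Θ' ((((g * ⟨circleDiagonal 3 ((fun i => z₀ i * Circle.exp (![(1 : ℝ), 0, -1] i * ψ)) ∘ ⇑ρ), circleDiagonal_mem_archLocal_diagonal L 3 α w _⟩ * g⁻¹ :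
          archLocal L 3 (Matrix.diagonal α) w) : GL (Fin 3) ℂ) : Matrix (Fin 3) (Fin 3) ℂ)) ∂ν) ψ =
      deriv (fun ψ : ℝ => (2 * Real.sin ψ : ℂ) * ∑ ρ : Perm (Fin 3),
        ∫ o, Θ ((((archPiEquivCM 3 L (Matrix.diagonal α)).symm o : arch (↥(maximalRealSubfield L)) L (IsCMField.complexConj L) 3 (Matrix.diagonal α)) :
            GL (Fin 3) (mixedSpace L)) : Matrix (Fin 3) (Fin 3) (mixedSpace L))
          ∂(Measure.pi (Function.update μall w (ν.map fun y : archLocal L 3 (Matrix.diagonal α) w =>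
            y * (⟨circleDiagonal 3 ((fun i => z₀ i * Circle.exp (![(1 : ℝ), 0, -1] i * ψ)) ∘ ⇑ρ), circleDiagonal_mem_archLocal_diagonal L 3 α w ((fun i => z₀ i * Circle.exp (![(1 : ℝ), 0, -1] i * ψ)) ∘ ⇑ρ)⟩ : archLocal L 3 (Matrix.diagonal α) w) * y⁻¹)))) ψ := by
    filter_upwards [Ioo_mem_nhdsGT hε] with ψ hψ
    refine Filter.EventuallyEq.deriv_eq ?_
    filter_upwards [isOpen_Ioo.mem_nhds hψ] with ψ' hψ'
    exact (hpt ψ' hψ'.1 hψ'.2).symm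
  have h2 := (hJ1 Θ' hΘ'd hΘ'c z₀ h02' h01').congr' hev
  convert h2 using 2
  refine Finset.sum_congr rfl fun ρ _ => ?_
  by_cases hρ : 0 < (w.1.embedding (α (ρ⁻¹ 0))).re * (w.1.embedding (α (ρ⁻¹ 2))).re
  · rw [if_pos hρ, if_pos hρ, integral_pi_update_map_conj_eq_integral L α w μall ν _ (fun C hC =>
      isCompact_setOf_conj_circleDiagonal_comp_perm_mem_of_compactWall L α w hα hreal z₀ h02' h01' ρ hρ C hC) Θ hΘ.continuous hΘc Θ' hΘ'd.continuous hΘ'eq]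
  · rw [if_neg hρ, if_neg hρ, integral_pi_update_singularOrbitMeasure_eq_integral_descConj L α w hα hherm μall ν ρ⁻¹ z₁ h02 h01 z₀ h02' h01' (νH ρ⁻¹)
      Θ hΘ.continuous hΘc Θ' hΘ'd.continuous hΘ'eq]

end Literature.NumberTheory.Rogawski1990

end
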